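import Mathlib
import Summits.NavierStokesRegularity.NavierStokesRegularity.Theses.CoreLogGas

/-!
# Route CoreLogGas — crux A `LocallyDrivenIsTypeI` (item stmt-NavierStokesRegularity-11290):
the admissibility clause of the locality hypothesis `H` is satisfiable at every regular slice

The locality hypothesis `H(M, t₀, g)` of the crux `CoreLogGas.LocallyDrivenIsTypeI` (and the
conclusion of its twin crux `CoreLogGas.BlowupIsLocallyDriven`) quantifies, at each time `t`, over
the *admissible core pairs* `(x, ρ)` of the vorticity slice `ω = curl (u t)`:

* `x` is a **deep** point, `(⨆ z, ‖ω z‖) ≤ 2 ‖ω x‖`;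
* `ball x ρ` is **inscribed** in the quarter-max set `Q = {y | (⨆ z, ‖ω z‖) ≤ 4 ‖ω y‖}`;
* `ρ` is **near-largest**: `ρ' ≤ 2 ρ` for every other deep `x'` and every `ρ'` with
  `ball x' ρ' ⊆ Q`.

Any proof that USES `H` (crux A) must first exhibit such a pair, and any audit of `H` must know
when the clause binds. This file settles that kinematic question in the crux's exact vocabulary:
for a continuous field `ω : ℝ³ → F` that tends to `0` at infinity and is not identically zero,

* `‖ω ·‖` is bounded, so `⨆ z, ‖ω z‖` is the honest supremum (no `Real.iSup` junk), and it is
  positive (`bddAbove_range_norm`, `iSup_norm_pos`);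
* the set of inscribed radii at deep points is bounded (`inscribedRadius_le`), and
* an admissible pair `(x, ρ)` with `0 < ρ` EXISTS (`exists_admissiblePair`), specialised to
  vorticity slices in `exists_admissiblePair_curl`.

So at every slice where the vorticity is continuous, decays at infinity and does not vanish
identically, the body of `H` is a genuine (non-vacuous) constraint; conversely it is vacuous
exactly on the slices excluded here (`ω ≡ 0`, or `‖ω ·‖` unbounded so that `⨆` is junk `0`), as
the refuter evidence on the item records. Elementary real analysis (compactness, `sSup`).
-/

-- the summit and its single sub-problem share the name (D-0017), as in every Theorems file here
set_option linter.dupNamespace false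

open Set Filter Topology Metric

namespace Summit.NavierStokesRegularity.NavierStokesRegularity.Theorems

namespace CoreLogGasLocallyDrivenIsTypeIAdmissiblePair

variable {F : Type*} [NormedAddCommGroup F]

/-- A continuous field on `ℝ³` tending to `0` at infinity is eventually small outside a compact
set: for every `ε > 0` there is a compact `K` with `‖ω z‖ < ε` off `K`. -/
theorem exists_isCompact_norm_lt {ω : (EuclideanSpace ℝ (Fin 3)) → F} (hdecay : Tendsto ω (cocompact (EuclideanSpace ℝ (Fin 3))) (𝓝 0))
    {ε : ℝ} (hε : 0 < ε) : ∃ K : Set (EuclideanSpace ℝ (Fin 3)), IsCompact K ∧ ∀ z, z ∉ K → ‖ω z‖ < ε := by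
  have h : ∀ᶠ z in cocompact (EuclideanSpace ℝ (Fin 3)), ‖ω z‖ < ε := by
    have := (Metric.tendsto_nhds.1 hdecay) ε hε
    simpa [dist_zero_right] using this
  obtain ⟨K, hK, hKsub⟩ := mem_cocompact.1 h
  exact ⟨K, hK, fun z hz => hKsub hz⟩

/-- A continuous field on `ℝ³` tending to `0` at infinity has bounded norm, so that
`⨆ z, ‖ω z‖` is the honest supremum of `‖ω ·‖`. -/
theorem bddAbove_range_norm {ω : (EuclideanSpace ℝ (Fin 3)) → F} (hcont : Continuous ω)
    (hdecay : Tendsto ω (cocompact (EuclideanSpace ℝ (Fin 3))) (𝓝 0)) : BddAbove (range fun z => ‖ω z‖) := by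
  obtain ⟨K, hK, hKlt⟩ := exists_isCompact_norm_lt hdecay one_pos
  obtain ⟨B, hB⟩ := hK.bddAbove_image hcont.norm.continuousOn
  refine ⟨max B 1, ?_⟩
  rintro _ ⟨z, rfl⟩
  by_cases hz : z ∈ K
  · exact (hB ⟨z, hz, rfl⟩).trans (le_max_left _ _)
  · exact (hKlt z hz).le.trans (le_max_right _ _)

/-- If moreover `ω` is not identically zero, then `0 < ⨆ z, ‖ω z‖`. -/
theorem iSup_norm_pos {ω : (EuclideanSpace ℝ (Fin 3)) → F} (hcont : Continuous ω)
    (hdecay : Tendsto ω (cocompact (EuclideanSpace ℝ (Fin 3))) (𝓝 0)) (hne : ∃ z, ω z ≠ 0) :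
    0 < ⨆ z, ‖ω z‖ := by
  obtain ⟨z, hz⟩ := hne
  exact (norm_pos_iff.2 hz).trans_le (le_ciSup (bddAbove_range_norm hcont hdecay) z)

/-- The quarter-max set `{y | (⨆ z, ‖ω z‖) ≤ 4 ‖ω y‖}` of a continuous field tending to `0` at
infinity and not identically zero is contained in some closed ball `closedBall 0 R₀`, `0 ≤ R₀`. -/
theorem quarterMax_subset_closedBall {ω : (EuclideanSpace ℝ (Fin 3)) → F} (hcont : Continuous ω)
    (hdecay : Tendsto ω (cocompact (EuclideanSpace ℝ (Fin 3))) (𝓝 0)) (hne : ∃ z, ω z ≠ 0) :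
    ∃ R₀ : ℝ, 0 ≤ R₀ ∧ {y | (⨆ z, ‖ω z‖) ≤ 4 * ‖ω y‖} ⊆ closedBall (0 : (EuclideanSpace ℝ (Fin 3))) R₀ := by
  have hΩ := iSup_norm_pos hcont hdecay hne
  obtain ⟨K, hK, hKlt⟩ := exists_isCompact_norm_lt hdecay (ε := (⨆ z, ‖ω z‖) / 4) (by positivity)
  obtain ⟨R, hR⟩ := hK.isBounded.subset_closedBall (0 : (EuclideanSpace ℝ (Fin 3)))
  refine ⟨max R 0, le_max_right _ _, fun y hy => ?_⟩
  have hyK : y ∈ K := by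
    by_contra hyK
    have h1 := hKlt y hyK
    have h2 : (⨆ z, ‖ω z‖) ≤ 4 * ‖ω y‖ := hy
    linarith
  exact closedBall_subset_closedBall (le_max_left _ _) (hR hyK)

/-- In `ℝ³`, a ball contained in `closedBall 0 R₀` (`0 ≤ R₀`) has radius at most `R₀`. -/
theorem radius_le_of_ball_subset_closedBall {x : (EuclideanSpace ℝ (Fin 3))} {r R₀ : ℝ} (hR₀ : 0 ≤ R₀)
    (h : ball x r ⊆ closedBall (0 : (EuclideanSpace ℝ (Fin 3))) R₀) : r ≤ R₀ := by
  by_contra hr'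
  have hr : R₀ < r := lt_of_not_ge hr'
  obtain ⟨t, hRt, htr⟩ := exists_between hr
  have ht : 0 < t := hR₀.trans_lt hRt
  set e : (EuclideanSpace ℝ (Fin 3)) := EuclideanSpace.single 0 (1 : ℝ) with he
  have hne : ‖e‖ = 1 := by simp [he]
  have hte : ‖t • e‖ = t := by rw [norm_smul, hne, mul_one, Real.norm_of_nonneg ht.le]
  have hplus : x + t • e ∈ ball x r := by
    rw [mem_ball, dist_eq_norm, add_sub_cancel_left, hte]; exact htr
  have hminus : x - t • e ∈ ball x r := by
    rw [mem_ball, dist_eq_norm, sub_sub_cancel_left, norm_neg, hte]; exact htr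
  have h1 : ‖x + t • e‖ ≤ R₀ := by simpa using h hplus
  have h2 : ‖x - t • e‖ ≤ R₀ := by simpa using h hminus
  have h3 : ‖(x + t • e) - (x - t • e)‖ ≤ ‖x + t • e‖ + ‖x - t • e‖ := norm_sub_le _ _
  have h4 : (x + t • e) - (x - t • e) = (2 * t) • e := by
    rw [add_sub_sub_cancel, ← add_smul, two_mul]
  rw [h4, norm_smul, hne, mul_one, Real.norm_of_nonneg (by positivity)] at h3
  linarith

/-- **Inscribed radii are bounded.** For a continuous field tending to `0` at infinity and not
identically zero there is `R₀ ≥ 0` bounding every radius `ρ'` of a ball inscribed in the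
quarter-max set (at any centre). -/
theorem inscribedRadius_le {ω : (EuclideanSpace ℝ (Fin 3)) → F} (hcont : Continuous ω)
    (hdecay : Tendsto ω (cocompact (EuclideanSpace ℝ (Fin 3))) (𝓝 0)) (hne : ∃ z, ω z ≠ 0) :
    ∃ R₀ : ℝ, 0 ≤ R₀ ∧ ∀ (x' : (EuclideanSpace ℝ (Fin 3))) (ρ' : ℝ),
      ball x' ρ' ⊆ {y | (⨆ z, ‖ω z‖) ≤ 4 * ‖ω y‖} → ρ' ≤ R₀ := by
  obtain ⟨R₀, hR₀, hQ⟩ := quarterMax_subset_closedBall hcont hdecay hne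
  exact ⟨R₀, hR₀, fun x' ρ' h => radius_le_of_ball_subset_closedBall hR₀ (h.trans hQ)⟩

/-- **Admissible core pairs exist** (the admissibility clause of the locality hypothesis `H` of
`CoreLogGas.LocallyDrivenIsTypeI` / `BlowupIsLocallyDriven` is satisfiable at every regular slice).
Let `ω : ℝ³ → F` be continuous, tend to `0` at infinity, and be not identically zero. Then there are
a deep point `x` (`(⨆ z, ‖ω z‖) ≤ 2 ‖ω x‖`) and a radius `ρ > 0` with `ball x ρ` inscribed in the
quarter-max set `{y | (⨆ z, ‖ω z‖) ≤ 4 ‖ω y‖}` and `ρ' ≤ 2 ρ` for every deep `x'` and every `ρ'`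
with `ball x' ρ'` inscribed in the quarter-max set. Proof: the set `S` of inscribed radii at deep
points is nonempty (a small ball at a point where `‖ω‖ > (⨆‖ω‖)/2`, by continuity) and bounded
(`inscribedRadius_le`); any element of `S` exceeding `sSup S / 2` is admissible. -/
theorem exists_admissiblePair {ω : (EuclideanSpace ℝ (Fin 3)) → F} (hcont : Continuous ω)
    (hdecay : Tendsto ω (cocompact (EuclideanSpace ℝ (Fin 3))) (𝓝 0)) (hne : ∃ z, ω z ≠ 0) :
    ∃ (x : (EuclideanSpace ℝ (Fin 3))) (ρ : ℝ), 0 < ρ ∧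
      (⨆ z, ‖ω z‖) ≤ 2 * ‖ω x‖ ∧
      ball x ρ ⊆ {y | (⨆ z, ‖ω z‖) ≤ 4 * ‖ω y‖} ∧
      ∀ (x' : (EuclideanSpace ℝ (Fin 3))) (ρ' : ℝ), (⨆ z, ‖ω z‖) ≤ 2 * ‖ω x'‖ →
        ball x' ρ' ⊆ {y | (⨆ z, ‖ω z‖) ≤ 4 * ‖ω y‖} → ρ' ≤ 2 * ρ := by
  have hbdd := bddAbove_range_norm hcont hdecay
  have hΩ := iSup_norm_pos hcont hdecay hne
  -- a point above half the supremum (deep) and a small inscribed ball around it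
  obtain ⟨z₀, hz₀⟩ : ∃ z₀, (⨆ z, ‖ω z‖) / 2 < ‖ω z₀‖ := exists_lt_of_lt_ciSup (half_lt_self hΩ)
  have hz₀deep : (⨆ z, ‖ω z‖) ≤ 2 * ‖ω z₀‖ := by linarith
  have hev : ∀ᶠ y in 𝓝 z₀, (⨆ z, ‖ω z‖) / 4 < ‖ω y‖ :=
    (hcont.norm.continuousAt (x := z₀)).eventually (lt_mem_nhds (by linarith))
  obtain ⟨δ, hδ, hδball⟩ := Metric.eventually_nhds_iff_ball.1 hev
  have hδins : ball z₀ δ ⊆ {y | (⨆ z, ‖ω z‖) ≤ 4 * ‖ω y‖} := fun y hy => by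
    have := hδball y hy
    show (⨆ z, ‖ω z‖) ≤ 4 * ‖ω y‖
    linarith
  -- the set of inscribed radii at deep points
  set S : Set ℝ := {r | ∃ x' : (EuclideanSpace ℝ (Fin 3)), (⨆ z, ‖ω z‖) ≤ 2 * ‖ω x'‖ ∧
    ball x' r ⊆ {y | (⨆ z, ‖ω z‖) ≤ 4 * ‖ω y‖}} with hS
  have hδS : δ ∈ S := ⟨z₀, hz₀deep, hδins⟩
  have hSne : S.Nonempty := ⟨δ, hδS⟩
  obtain ⟨R₀, hR₀, hRle⟩ := inscribedRadius_le hcont hdecay hne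
  have hSbdd : BddAbove S := ⟨R₀, fun r ⟨x', _, hx'⟩ => hRle x' r hx'⟩
  have hRstar : 0 < sSup S := hδ.trans_le (le_csSup hSbdd hδS)
  -- any inscribed radius above half the supremum is admissible
  obtain ⟨r₁, hr₁S, hr₁⟩ := exists_lt_of_lt_csSup hSne (half_lt_self hRstar)
  obtain ⟨x, hxdeep, hxins⟩ := hr₁S
  refine ⟨x, r₁, by linarith, hxdeep, hxins, fun x' ρ' hx' hins' => ?_⟩
  have hρ'S : ρ' ∈ S := ⟨x', hx', hins'⟩
  have := le_csSup hSbdd hρ'S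
  linarith

/-- **Admissible core pairs exist for a vorticity slice** — `exists_admissiblePair` with
`ω := curl (u t)`, literally the three admissibility premises of the locality hypothesis `H` in
`CoreLogGas.LocallyDrivenIsTypeI` (stmt-NavierStokesRegularity-11290) and in the conclusion of
`CoreLogGas.BlowupIsLocallyDriven`: at every time `t` at which the vorticity `curl (u t)` is
continuous, tends to `0` at spatial infinity and is not identically zero, some deep point carries a
near-largest inscribed quarter-max ball, so `H` binds there (it is not vacuous). -/
theorem exists_admissiblePair_curl
    (u : ℝ → EuclideanSpace ℝ (Fin 3) → EuclideanSpace ℝ (Fin 3)) (t : ℝ)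
    (hcont : Continuous (Literature.Analysis.FluidPDE.curl (u t)))
    (hdecay : Tendsto (Literature.Analysis.FluidPDE.curl (u t)) (cocompact _) (𝓝 0))
    (hne : ∃ z, Literature.Analysis.FluidPDE.curl (u t) z ≠ 0) :
    ∃ (x : EuclideanSpace ℝ (Fin 3)) (ρ : ℝ), 0 < ρ ∧
      (⨆ z, ‖Literature.Analysis.FluidPDE.curl (u t) z‖) ≤
        2 * ‖Literature.Analysis.FluidPDE.curl (u t) x‖ ∧
      Metric.ball x ρ ⊆ {y | (⨆ z, ‖Literature.Analysis.FluidPDE.curl (u t) z‖) ≤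
        4 * ‖Literature.Analysis.FluidPDE.curl (u t) y‖} ∧
      ∀ (x' : EuclideanSpace ℝ (Fin 3)) (ρ' : ℝ),
        (⨆ z, ‖Literature.Analysis.FluidPDE.curl (u t) z‖) ≤
          2 * ‖Literature.Analysis.FluidPDE.curl (u t) x'‖ →
        Metric.ball x' ρ' ⊆ {y | (⨆ z, ‖Literature.Analysis.FluidPDE.curl (u t) z‖) ≤
          4 * ‖Literature.Analysis.FluidPDE.curl (u t) y‖} →
        ρ' ≤ 2 * ρ :=
  exists_admissiblePair hcont hdecay hne

/-- **The locality hypothesis binds at every regular slice.** If the body of `H(M, t₀, g)` (verbatim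
from `CoreLogGas.LocallyDrivenIsTypeI`, stmt-NavierStokesRegularity-11290) holds on `Ico t₀ T`, then at
every `t ∈ Ico t₀ T` at which the vorticity `curl (u t)` is continuous, tends to `0` at infinity and
is not identically zero, there is an admissible deep pair `(x, ρ)`, `0 < ρ`, AT WHICH the exterior
symmetric-gradient bound `|⟪(∇u(t,x) − ∇ BS[1_{ball x (Mρ)} ω(t)](x)) e, e⟫| ≤ g t` is in force for
every unit vector `e` — the first step of any argument that uses `H`. -/
theorem locality_binds
    (u : ℝ → EuclideanSpace ℝ (Fin 3) → EuclideanSpace ℝ (Fin 3)) (M t₀ T : ℝ) (g : ℝ → ℝ)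
    (hH : ∀ t ∈ Set.Ico t₀ T, ∀ (x : EuclideanSpace ℝ (Fin 3)) (ρ : ℝ), 0 < ρ →
        (⨆ z, ‖Literature.Analysis.FluidPDE.curl (u t) z‖) ≤ 2 * ‖Literature.Analysis.FluidPDE.curl (u t) x‖ →
        Metric.ball x ρ ⊆ {y | (⨆ z, ‖Literature.Analysis.FluidPDE.curl (u t) z‖) ≤ 4 * ‖Literature.Analysis.FluidPDE.curl (u t) y‖} →
        (∀ (x' : EuclideanSpace ℝ (Fin 3)) (ρ' : ℝ),
          (⨆ z, ‖Literature.Analysis.FluidPDE.curl (u t) z‖) ≤ 2 * ‖Literature.Analysis.FluidPDE.curl (u t) x'‖ →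
          Metric.ball x' ρ' ⊆ {y | (⨆ z, ‖Literature.Analysis.FluidPDE.curl (u t) z‖) ≤ 4 * ‖Literature.Analysis.FluidPDE.curl (u t) y‖} →
          ρ' ≤ 2 * ρ) →
        ∀ e : EuclideanSpace ℝ (Fin 3), ‖e‖ = 1 →
          |inner ℝ ((fderiv ℝ (u t) x - fderiv ℝ (fun z : EuclideanSpace ℝ (Fin 3) =>
            ∫ y, (4 * Real.pi * ‖z - y‖ ^ 3)⁻¹ • Literature.Analysis.FluidPDE.cross
              ((Metric.ball x (M * ρ)).indicator (Literature.Analysis.FluidPDE.curl (u t)) y) (z - y)) x) e) e| ≤ g t)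
    {t : ℝ} (ht : t ∈ Set.Ico t₀ T)
    (hcont : Continuous (Literature.Analysis.FluidPDE.curl (u t)))
    (hdecay : Tendsto (Literature.Analysis.FluidPDE.curl (u t)) (cocompact _) (𝓝 0))
    (hne : ∃ z, Literature.Analysis.FluidPDE.curl (u t) z ≠ 0) :
    ∃ (x : EuclideanSpace ℝ (Fin 3)) (ρ : ℝ), 0 < ρ ∧
      (⨆ z, ‖Literature.Analysis.FluidPDE.curl (u t) z‖) ≤ 2 * ‖Literature.Analysis.FluidPDE.curl (u t) x‖ ∧
      Metric.ball x ρ ⊆ {y | (⨆ z, ‖Literature.Analysis.FluidPDE.curl (u t) z‖) ≤ 4 * ‖Literature.Analysis.FluidPDE.curl (u t) y‖} ∧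
      (∀ (x' : EuclideanSpace ℝ (Fin 3)) (ρ' : ℝ),
        (⨆ z, ‖Literature.Analysis.FluidPDE.curl (u t) z‖) ≤ 2 * ‖Literature.Analysis.FluidPDE.curl (u t) x'‖ →
        Metric.ball x' ρ' ⊆ {y | (⨆ z, ‖Literature.Analysis.FluidPDE.curl (u t) z‖) ≤ 4 * ‖Literature.Analysis.FluidPDE.curl (u t) y‖} →
        ρ' ≤ 2 * ρ) ∧
      ∀ e : EuclideanSpace ℝ (Fin 3), ‖e‖ = 1 →
        |inner ℝ ((fderiv ℝ (u t) x - fderiv ℝ (fun z : EuclideanSpace ℝ (Fin 3) =>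
          ∫ y, (4 * Real.pi * ‖z - y‖ ^ 3)⁻¹ • Literature.Analysis.FluidPDE.cross
            ((Metric.ball x (M * ρ)).indicator (Literature.Analysis.FluidPDE.curl (u t)) y) (z - y)) x) e) e| ≤ g t := by
  obtain ⟨x, ρ, hρ, hdeep, hins, hmax⟩ := exists_admissiblePair_curl u t hcont hdecay hne
  exact ⟨x, ρ, hρ, hdeep, hins, hmax, hH t ht x ρ hρ hdeep hins hmax⟩

/-- **`g` is nonnegative wherever `H` binds.** Under the body of `H(M, t₀, g)`, at every
`t ∈ Ico t₀ T` with continuous, decaying, not identically zero vorticity, `0 ≤ g t` (test the bound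
of `locality_binds` on the unit vector `EuclideanSpace.single 0 1`). In particular the integrable
majorant `g` of `H` may be assumed nonnegative on the regular part of `[t₀, T)` at no cost. -/
theorem g_nonneg_of_locality
    (u : ℝ → EuclideanSpace ℝ (Fin 3) → EuclideanSpace ℝ (Fin 3)) (M t₀ T : ℝ) (g : ℝ → ℝ)
    (hH : ∀ t ∈ Set.Ico t₀ T, ∀ (x : EuclideanSpace ℝ (Fin 3)) (ρ : ℝ), 0 < ρ →
        (⨆ z, ‖Literature.Analysis.FluidPDE.curl (u t) z‖) ≤ 2 * ‖Literature.Analysis.FluidPDE.curl (u t) x‖ →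
        Metric.ball x ρ ⊆ {y | (⨆ z, ‖Literature.Analysis.FluidPDE.curl (u t) z‖) ≤ 4 * ‖Literature.Analysis.FluidPDE.curl (u t) y‖} →
        (∀ (x' : EuclideanSpace ℝ (Fin 3)) (ρ' : ℝ),
          (⨆ z, ‖Literature.Analysis.FluidPDE.curl (u t) z‖) ≤ 2 * ‖Literature.Analysis.FluidPDE.curl (u t) x'‖ →
          Metric.ball x' ρ' ⊆ {y | (⨆ z, ‖Literature.Analysis.FluidPDE.curl (u t) z‖) ≤ 4 * ‖Literature.Analysis.FluidPDE.curl (u t) y‖} →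
          ρ' ≤ 2 * ρ) →
        ∀ e : EuclideanSpace ℝ (Fin 3), ‖e‖ = 1 →
          |inner ℝ ((fderiv ℝ (u t) x - fderiv ℝ (fun z : EuclideanSpace ℝ (Fin 3) =>
            ∫ y, (4 * Real.pi * ‖z - y‖ ^ 3)⁻¹ • Literature.Analysis.FluidPDE.cross
              ((Metric.ball x (M * ρ)).indicator (Literature.Analysis.FluidPDE.curl (u t)) y) (z - y)) x) e) e| ≤ g t)
    {t : ℝ} (ht : t ∈ Set.Ico t₀ T)
    (hcont : Continuous (Literature.Analysis.FluidPDE.curl (u t)))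
    (hdecay : Tendsto (Literature.Analysis.FluidPDE.curl (u t)) (cocompact _) (𝓝 0))
    (hne : ∃ z, Literature.Analysis.FluidPDE.curl (u t) z ≠ 0) :
    0 ≤ g t := by
  obtain ⟨x, ρ, -, -, -, -, hbound⟩ := locality_binds u M t₀ T g hH ht hcont hdecay hne
  have he : ‖(EuclideanSpace.single 0 (1 : ℝ) : EuclideanSpace ℝ (Fin 3))‖ = 1 := by simp
  exact (abs_nonneg _).trans (hbound _ he)

/-- **Registered helper stub `stub_admissiblePair`** of crux A (stmt-NavierStokesRegularity-11290; a
kinematic HELPER registered by lead c4, not one of the three composition stubs of line `registered`):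
the closed form of `exists_admissiblePair_curl` — at every slice with continuous, decaying, not
identically zero vorticity an admissible deep pair `(x, ρ)`, `0 < ρ`, exists, i.e. the locality
hypothesis `H` of `CoreLogGas.LocallyDrivenIsTypeI` binds there. -/
theorem stub_admissiblePair : ∀ (u : ℝ → EuclideanSpace ℝ (Fin 3) → EuclideanSpace ℝ (Fin 3)) (t : ℝ), Continuous (Literature.Analysis.FluidPDE.curl (u t)) → Filter.Tendsto (Literature.Analysis.FluidPDE.curl (u t)) (Filter.cocompact (EuclideanSpace ℝ (Fin 3))) (nhds 0) → (∃ z, Literature.Analysis.FluidPDE.curl (u t) z ≠ 0) → ∃ (x : EuclideanSpace ℝ (Fin 3)) (ρ : ℝ), 0 < ρ ∧ (⨆ z, ‖Literature.Analysis.FluidPDE.curl (u t) z‖) ≤ 2 * ‖Literature.Analysis.FluidPDE.curl (u t) x‖ ∧ Metric.ball x ρ ⊆ {y | (⨆ z, ‖Literature.Analysis.FluidPDE.curl (u t) z‖) ≤ 4 * ‖Literature.Analysis.FluidPDE.curl (u t) y‖} ∧ ∀ (x' : EuclideanSpace ℝ (Fin 3)) (ρ' : ℝ), (⨆ z, ‖Literature.Analysis.FluidPDE.curl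 (u t) z‖) ≤ 2 * ‖Literature.Analysis.FluidPDE.curl (u t) x'‖ → Metric.ball x' ρ' ⊆ {y | (⨆ z, ‖Literature.Analysis.FluidPDE.curl (u t) z‖) ≤ 4 * ‖Literature.Analysis.FluidPDE.curl (u t) y‖} → ρ' ≤ 2 * ρ :=
  fun u t hcont hdecay hne => exists_admissiblePair_curl u t hcont hdecay hne

open MeasureTheory in
/-- **Core enstrophy lower bound at an inscribed ball.** If `ball x ρ` (`0 ≤ ρ`) is inscribed in the
quarter-max set `{y | (⨆ z, ‖ω z‖) ≤ 4 ‖ω y‖}` of a field `ω : ℝ³ → F`, then the enstrophy carried by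
the ball is at least `((⨆‖ω‖)/4)² · |ball x ρ| = ((⨆‖ω‖)/4)² · (4π/3) ρ³`:
`ENNReal.ofReal (((⨆ z, ‖ω z‖) / 4) ^ 2 * (Real.pi * 4 / 3 * ρ ^ 3)) ≤ ∫⁻ y, ‖ω y‖ₑ ^ 2` (lower Lebesgue
integral, no integrability assumed). With `ρ ≥ R*/2` at an admissible pair this is the inequality
`Ω(t)² R*(t)³ ≲ ‖ω(t)‖₂²` ("cores shrink": `∫ Ω² R*³ dt < ∞` along a Leray–Hopf solution). -/
theorem core_enstrophy_lower {ω : (EuclideanSpace ℝ (Fin 3)) → F} {x : EuclideanSpace ℝ (Fin 3)}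
    {ρ : ℝ} (hρ : 0 ≤ ρ)
    (hins : ball x ρ ⊆ {y | (⨆ z, ‖ω z‖) ≤ 4 * ‖ω y‖}) :
    ENNReal.ofReal (((⨆ z, ‖ω z‖) / 4) ^ 2 * (Real.pi * 4 / 3 * ρ ^ 3)) ≤
      ∫⁻ y, ‖ω y‖ₑ ^ 2 := by
  have hvol : volume (ball x ρ) = ENNReal.ofReal (Real.pi * 4 / 3 * ρ ^ 3) := by
    rw [EuclideanSpace.volume_ball_fin_three x ρ, ← ENNReal.ofReal_pow hρ, ← ENNReal.ofReal_mul
      (by positivity)]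
    ring_nf
  have hpt : ∀ y ∈ ball x ρ, ENNReal.ofReal (((⨆ z, ‖ω z‖) / 4) ^ 2) ≤ ‖ω y‖ₑ ^ 2 := by
    intro y hy
    have h4 : (⨆ z, ‖ω z‖) / 4 ≤ ‖ω y‖ := by
      have := hins hy
      simp only [Set.mem_setOf_eq] at this
      linarith
    by_cases hneg : (⨆ z, ‖ω z‖) / 4 ≤ 0
    · -- then `Ω/4 ≤ 0 ≤ ‖ω y‖`, and `(Ω/4)² ≤ ‖ω y‖²` still holds since `Ω ≥ 0` forces `Ω = 0`
      have hΩ0 : (⨆ z, ‖ω z‖) / 4 = 0 :=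
        le_antisymm hneg (div_nonneg (Real.iSup_nonneg fun z => norm_nonneg _) (by norm_num))
      simp [hΩ0]
    · have hpos : 0 ≤ (⨆ z, ‖ω z‖) / 4 := le_of_not_ge hneg
      calc ENNReal.ofReal (((⨆ z, ‖ω z‖) / 4) ^ 2)
          ≤ ENNReal.ofReal (‖ω y‖ ^ 2) := ENNReal.ofReal_le_ofReal (by gcongr)
        _ = ‖ω y‖ₑ ^ 2 := by
          rw [← ofReal_norm, ENNReal.ofReal_pow (norm_nonneg _)]
  calc ENNReal.ofReal (((⨆ z, ‖ω z‖) / 4) ^ 2 * (Real.pi * 4 / 3 * ρ ^ 3))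
      = ENNReal.ofReal (((⨆ z, ‖ω z‖) / 4) ^ 2) * volume (ball x ρ) := by
        rw [hvol, ENNReal.ofReal_mul (sq_nonneg _)]
    _ = ∫⁻ _ in ball x ρ, ENNReal.ofReal (((⨆ z, ‖ω z‖) / 4) ^ 2) := by
        rw [setLIntegral_const]
    _ ≤ ∫⁻ y in ball x ρ, ‖ω y‖ₑ ^ 2 := setLIntegral_mono' measurableSet_ball hpt
    _ ≤ ∫⁻ y, ‖ω y‖ₑ ^ 2 := setLIntegral_le_lintegral _ _

/-- **Registered helper stub `stub_coreEnstrophyLower`** of crux A (stmt-NavierStokesRegularity-11290; a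
kinematic HELPER registered by lead c4, not a composition stub of line `registered`): the closed form of
`core_enstrophy_lower` for vorticity-valued fields — an inscribed quarter-max ball of radius `ρ` carries
enstrophy `≥ ((⨆‖ω‖)/4)² (4π/3) ρ³`. -/
theorem stub_coreEnstrophyLower : ∀ (ω : EuclideanSpace ℝ (Fin 3) → EuclideanSpace ℝ (Fin 3)) (x : EuclideanSpace ℝ (Fin 3)) (ρ : ℝ), 0 ≤ ρ → Metric.ball x ρ ⊆ {y | (⨆ z, ‖ω z‖) ≤ 4 * ‖ω y‖} → ENNReal.ofReal (((⨆ z, ‖ω z‖) / 4) ^ 2 * (Real.pi * 4 / 3 * ρ ^ 3)) ≤ MeasureTheory.lintegral MeasureTheory.MeasureSpace.volume (fun y => ‖ω y‖ₑ ^ 2) :=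
  fun _ _ _ hρ hins => core_enstrophy_lower hρ hins

end CoreLogGasLocallyDrivenIsTypeIAdmissiblePair

end Summit.NavierStokesRegularity.NavierStokesRegularity.Theorems
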